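import Literature.Geometry.Lorentzian.ChartSecondFundamentalForm
import Literature.Geometry.Lorentzian.HypersurfaceRestriction
import Literature.Geometry.Lorentzian.CurveThroughVelocity
import Mathlib.Analysis.Calculus.Deriv.CompMul

/-!
# Dilation covariance of the second fundamental form on chart domains

Let `g`, `g'` be metrics on chart domains `V, V' ⊆ E` whose components are related by the
dilation `x ↦ l x` (`l > 0`): `g'(x') = G(x'/l)`, `g(x) = G(x)`. Let `f : U → V`, `f' : U' → V'`
(chart domains `U, U' ⊆ E'`) and `σ : U' → U` with `σ(z) = z/l`, `f'(z) = l f(σ z)`, and fields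
`ν`, `ν'` along `f`, `f'` with `ν'(z) = ν(σ z)` — NO regularity of `ν` is assumed. Then
`K^{g'}_{f',ν'}(z) = l⁻¹ K^{g}_{f,ν}(σ z)` exactly (junk values included): the Christoffel
symbols scale by `l⁻¹` (`∂g' = l⁻¹ ∂g`), the chart-straight curves correspond under
`t ↦ t/l`, and the frame formula defining `D_v ν` is otherwise literal. O'Neill 1983, Ch. 3,
Prop. 3.13 and 3.18; Ch. 4, Lemma 4.4.

* `OpensChart.christoffel_shrink` — `Γ^{g'}_{lx} = l⁻¹ Γ^{g}_{x}`;
* `OpensChart.mfderiv_dilate_apply`, `mfderiv_dilate_apply'` — `d(l f(·/l))_z = df_{z/l}`;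
* `OpensChart.normalDerivAlong_dilate` — `D^{g'}_v ν'(z) = l⁻¹ D^{g}_v ν(z/l)`;
* `OpensChart.secondFundamentalForm_dilate` — `K^{g'}_{f',ν'}(z) = l⁻¹ K^{g}_{f,ν}(z/l)`.

Everything is proved; no definitions, no named facts.

## References

* B. O'Neill, *Semi-Riemannian geometry* (1983), Ch. 3, Prop. 3.13, Prop. 3.18; Ch. 4,
  Lemma 4.1, Lemma 4.4. [ONeill1983]
-/

noncomputable section

-- instance search through the nested operator type `E →L[ℝ] E →L[ℝ] ℝ` (as in the tree files)
set_option maxSynthPendingDepth 3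

open Bundle Set Function Filter Manifold TopologicalSpace Module
open scoped Manifold ContDiff Topology

namespace Literature.Geometry.Lorentzian

namespace OpensChart

variable {E : Type*} [NormedAddCommGroup E] [NormedSpace ℝ E] [FiniteDimensional ℝ E]
  {E' : Type*} [NormedAddCommGroup E'] [NormedSpace ℝ E']
  {V V' : Opens E} {U U' : Opens E'}

/-! ### The frame formula on a chart domain, unconditionally -/

/-- **The canonical-frame formula for `DW/dt` on a chart domain `V ⊆ E`, with no regularity
hypothesis**: `DW/dt(t₀) = ∑ᵢ (bⁱ(W))'(t₀) bᵢ + ∑ᵢ bⁱ(W t₀) ∇_{γ'(t₀)} bᵢ` in the constant frame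
`bᵢ = Module.finBasis` (the definition of `covariantDerivAlong`, read through the identity
trivialisation of `TV`). O'Neill 1983, Ch. 3, Prop. 3.18. [cite: ONeill1983, Ch. 3, Prop. 3.18] -/
theorem covariantDerivAlong_eq_sum
    (cov : CovariantDerivative 𝓘(ℝ, E) E (TangentSpace 𝓘(ℝ, E) : V → Type _)) (γ : ℝ → V)
    (W : Π t : ℝ, TangentSpace 𝓘(ℝ, E) (γ t)) (t₀ : ℝ) :
    (id (covariantDerivAlong cov γ W t₀) : E) =
      ∑ i, deriv (fun t ↦ (Module.finBasis ℝ E).repr (W t) i) t₀ • (Module.finBasis ℝ E i : E) +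
      ∑ i, (Module.finBasis ℝ E).repr (W t₀) i •
        (id (cov (fun _ : V ↦ (Module.finBasis ℝ E i : E)) (γ t₀) (velocity 𝓘(ℝ, E) γ t₀)) : E) := by
  rw [covariantDerivAlong_def]
  unfold covariantDerivAlongFrame
  simp only [localFrame_coeff_trivializationAt, localFrame_trivializationAt]
  rfl

omit [FiniteDimensional ℝ E] in
/-- The chart-straight curve of a chart domain is the straight line, near `t = 0`:
`curveThrough y v t = y + t v` in `E'` for small `|t|`. [folklore] -/
theorem coe_curveThrough_eventuallyEq (y : U) (v : E') :
    ∀ᶠ t in 𝓝 (0 : ℝ), ((curveThrough 𝓘(ℝ, E') y v t : U) : E') = (y : E') + t • v := by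
  filter_upwards [subtypeVal_comp_curveThrough_eventuallyEq (I' := 𝓘(ℝ, E')) (W := U) y v]
    with t ht
  rw [show ((curveThrough 𝓘(ℝ, E') y v t : U) : E') = (Subtype.val ∘ curveThrough 𝓘(ℝ, E') y v) t
    from rfl, ht]
  simp [curveThrough]

omit [FiniteDimensional ℝ E] in
/-- Chain rule for velocities: `(f ∘ c)'(0) = df (c'(0))`. [folklore] -/
theorem velocity_comp_zero {f : U → V} {c : ℝ → U} (hf : MDifferentiableAt 𝓘(ℝ, E') 𝓘(ℝ, E) f (c 0))
    (hc : MDifferentiableAt 𝓘(ℝ, ℝ) 𝓘(ℝ, E') c 0) :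
    velocity 𝓘(ℝ, E) (f ∘ c) 0 = mfderiv 𝓘(ℝ, E') 𝓘(ℝ, E) f (c 0) (velocity 𝓘(ℝ, E') c 0) := by
  simp only [velocity]
  rw [mfderiv_comp 0 hf hc]
  rfl

/-! ### Representatives of maps between chart domains -/

omit [FiniteDimensional ℝ E] [NormedSpace ℝ E] [NormedSpace ℝ E'] in
/-- A map `f : U → V` between chart domains has the global representative
`Φ = (y ↦ f y on U, 0 off U)`. [folklore] -/
theorem exists_repr (f : U → V) : ∃ Φ : E' → E, ∀ y : U, (f y : E) = Φ y := by
  classical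
  exact ⟨fun y ↦ if h : y ∈ U then (f ⟨y, h⟩ : E) else 0, fun y ↦ by simp⟩

omit [FiniteDimensional ℝ E] in
/-- Differentiability of a map between chart domains is differentiability of its representative.
[folklore] -/
theorem differentiableAt_of_repr {f : U → V} {Φ : E' → E} (hf : ∀ y : U, (f y : E) = Φ y) {y : U}
    (hfd : MDifferentiableAt 𝓘(ℝ, E') 𝓘(ℝ, E) f y) : DifferentiableAt ℝ Φ y := by
  have hval : MDifferentiableAt 𝓘(ℝ, E) 𝓘(ℝ, E) (Subtype.val : V → E) (f y) :=
    (contMDiff_subtype_val (n := ∞) (f y)).mdifferentiableAt (by simp)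
  exact (mdifferentiableAt_iff y (Subtype.val ∘ f) Φ hf).1 (hval.comp y hfd)

/-! ### The dilation covariance -/

variable {n : ℕ∞ω} [Fact (1 ≤ n)]
  {g : PseudoRiemannianMetric 𝓘(ℝ, E) n E (TangentSpace 𝓘(ℝ, E) : V → Type _)}
  {g' : PseudoRiemannianMetric 𝓘(ℝ, E) n E (TangentSpace 𝓘(ℝ, E) : V' → Type _)}
  {G : E → E →L[ℝ] E →L[ℝ] ℝ} {l : ℝ}

omit [Fact (1 ≤ n)] [FiniteDimensional ℝ E] in
/-- The Koszul form of the dilated components `G(·/l)` at `x'` is `l⁻¹` times that of `G` at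
`x'/l`. [folklore] -/
theorem koszulForm_comp_shrink {x' : E} (hGd : DifferentiableAt ℝ G (l⁻¹ • x')) (Y₀ X₀ Z₀ : E) :
    koszulForm (fun x ↦ G (l⁻¹ • x)) x' Y₀ X₀ Z₀ = l⁻¹ * koszulForm G (l⁻¹ • x') Y₀ X₀ Z₀ := by
  have hL : DifferentiableAt ℝ (fun x : E ↦ l⁻¹ • x) x' := (l⁻¹ • ContinuousLinearMap.id ℝ E).differentiableAt
  have hd : fderiv ℝ (fun x ↦ G (l⁻¹ • x)) x' = (fderiv ℝ G (l⁻¹ • x')).comp (l⁻¹ • ContinuousLinearMap.id ℝ E) := by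
    rw [show (fun x ↦ G (l⁻¹ • x)) = G ∘ (fun x : E ↦ l⁻¹ • x) from rfl, fderiv_comp x' hGd hL]
    congr 1
    exact (l⁻¹ • ContinuousLinearMap.id ℝ E).fderiv
  have happ : ∀ A : E, fderiv ℝ (fun x ↦ G (l⁻¹ • x)) x' A = l⁻¹ • fderiv ℝ G (l⁻¹ • x') A := by
    intro A
    rw [hd, ContinuousLinearMap.comp_apply, FunLike.coe_smul, Pi.smul_apply,
      ContinuousLinearMap.id_apply, map_smul]
  simp only [koszulForm_apply, happ, FunLike.coe_smul, Pi.smul_apply, smul_eq_mul]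
  ring

omit [Fact (1 ≤ n)] in
/-- Index raising agrees for two metrics with the same components at corresponding points
(the chart specialisation of `PseudoRiemannianMetric.sharp_congr_of_val_eq`,
`HypersurfaceRestriction.lean`, kept under this name and signature for its users). [folklore] -/
theorem sharp_eq_of_val_eq {x : V} {x' : V'}
    (h : (g'.val x' : E →L[ℝ] E →L[ℝ] ℝ) = (g.val x : E →L[ℝ] E →L[ℝ] ℝ)) (α : Module.Dual ℝ E) :
    (g'.sharp x' α : E) = g.sharp x α :=
  PseudoRiemannianMetric.sharp_congr_of_val_eq h α

omit [Fact (1 ≤ n)] in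
/-- **The Christoffel symbols of the dilated metric scale by `l⁻¹`**:
`Γ^{g'}_{x'}(Y₀)(X₀) = l⁻¹ Γ^{g}_{x}(Y₀)(X₀)` for `x' = l x`, `g'(x') = G(x'/l)`, `g(x) = G(x)`.
O'Neill 1983, Ch. 3, Prop. 3.13. [cite: ONeill1983, Ch. 3, Prop. 3.13] -/
theorem christoffel_shrink (hG : ∀ x : V, g.val x = G x)
    (hG' : ∀ x' : V', g'.val x' = G (l⁻¹ • (x' : E))) {x : V} {x' : V'}
    (hx : l⁻¹ • (x' : E) = x) (hGd : DifferentiableAt ℝ G x) (Y₀ X₀ : E) :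
    (christoffel g' (fun x ↦ G (l⁻¹ • x)) x' Y₀ X₀ : E) = l⁻¹ • christoffel g G x Y₀ X₀ := by
  have hval : (g'.val x' : E →L[ℝ] E →L[ℝ] ℝ) = (g.val x : E →L[ℝ] E →L[ℝ] ℝ) := by
    rw [hG', hG, hx]
  have hGd' : DifferentiableAt ℝ G (l⁻¹ • (x' : E)) := by rw [hx]; exact hGd
  have hk : (2 : ℝ)⁻¹ • koszulForm (fun x ↦ G (l⁻¹ • x)) (x' : E) Y₀ X₀ =
      l⁻¹ • ((2 : ℝ)⁻¹ • koszulForm G (x : E) Y₀ X₀) := by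
    refine LinearMap.ext fun Z₀ ↦ ?_
    simp only [LinearMap.smul_apply, koszulForm_comp_shrink hGd', hx, smul_eq_mul]
    ring
  rw [christoffel_apply, christoffel_apply, hk, sharp_eq_of_val_eq hval]
  exact (g.sharp x).map_smul l⁻¹ _

variable (hl : 0 < l) {f : U → V} {f' : U' → V'} {σ : U' → U}
  (hσ : ∀ z, (σ z : E') = l⁻¹ • (z : E')) (hf' : ∀ z, (f' z : E) = l • (f (σ z) : E))
include hl hσ hf'

omit [FiniteDimensional ℝ E] [NormedSpace ℝ E'] hσ in
/-- The base points correspond: `f' z / l = f (σ z)`. [folklore] -/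
theorem inv_smul_coe_eq (z : U') : l⁻¹ • (f' z : E) = f (σ z) := by
  rw [hf', smul_smul, inv_mul_cancel₀ hl.ne', one_smul]

omit [FiniteDimensional ℝ E] in
/-- **The differentials correspond**: `df'_z = df_{σ z}` (as maps of `E'`), for `f` differentiable
at `σ z`. [folklore] -/
theorem mfderiv_dilate_apply {z : U'} (hfd : MDifferentiableAt 𝓘(ℝ, E') 𝓘(ℝ, E) f (σ z)) (v : E') :
    mfderiv 𝓘(ℝ, E') 𝓘(ℝ, E) f' z v = mfderiv 𝓘(ℝ, E') 𝓘(ℝ, E) f (σ z) v := by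
  obtain ⟨Φ, hΦ⟩ := exists_repr f
  have hΦd : DifferentiableAt ℝ Φ (σ z) := differentiableAt_of_repr hΦ hfd
  have hΦd' : DifferentiableAt ℝ Φ (l⁻¹ • (z : E')) := by rw [← hσ]; exact hΦd
  have hrep : ∀ y : U', (f' y : E) = (fun y' : E' ↦ l • Φ (l⁻¹ • y')) y := fun y ↦ by
    simp only [hf', hΦ, hσ]
  have hL : DifferentiableAt ℝ (fun y' : E' ↦ l⁻¹ • y') z :=
    (l⁻¹ • ContinuousLinearMap.id ℝ E').differentiableAt
  have hcomp : DifferentiableAt ℝ (fun y' : E' ↦ Φ (l⁻¹ • y')) z := by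
    have := hΦd'.comp (z : E') hL; exact this
  have hΦ'd : DifferentiableAt ℝ (fun y' : E' ↦ l • Φ (l⁻¹ • y')) z := hcomp.const_smul l
  rw [mfderiv_apply_of_repr hrep hΦ'd, mfderiv_apply_of_repr hΦ hΦd, fderiv_fun_const_smul hcomp,
    show (fun y' : E' ↦ Φ (l⁻¹ • y')) = Φ ∘ (fun y' : E' ↦ l⁻¹ • y') from rfl,
    fderiv_comp (z : E') hΦd' hL]
  have hfL : fderiv ℝ (fun y' : E' ↦ l⁻¹ • y') (z : E') = l⁻¹ • ContinuousLinearMap.id ℝ E' :=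
    (l⁻¹ • ContinuousLinearMap.id ℝ E').fderiv
  rw [hfL, hσ]
  change l • fderiv ℝ Φ (l⁻¹ • (z : E')) (l⁻¹ • v) = fderiv ℝ Φ (l⁻¹ • (z : E')) v
  rw [map_smul, smul_smul, mul_inv_cancel₀ hl.ne', one_smul]

omit [FiniteDimensional ℝ E] hl in
/-- `f'` is differentiable where `f` is. [folklore] -/
theorem mdifferentiableAt_dilate {z : U'} (hfd : MDifferentiableAt 𝓘(ℝ, E') 𝓘(ℝ, E) f (σ z)) :
    MDifferentiableAt 𝓘(ℝ, E') 𝓘(ℝ, E) f' z := by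
  obtain ⟨Φ, hΦ⟩ := exists_repr f
  have hΦd : DifferentiableAt ℝ Φ (σ z) := differentiableAt_of_repr hΦ hfd
  have hΦd' : DifferentiableAt ℝ Φ (l⁻¹ • (z : E')) := by rw [← hσ]; exact hΦd
  have hrep : ∀ y : U', (f' y : E) = (fun y' : E' ↦ l • Φ (l⁻¹ • y')) y := fun y ↦ by
    simp only [hf', hΦ, hσ]
  have hL : DifferentiableAt ℝ (fun y' : E' ↦ l⁻¹ • y') z :=
    (l⁻¹ • ContinuousLinearMap.id ℝ E').differentiableAt
  have hcomp : DifferentiableAt ℝ (fun y' : E' ↦ Φ (l⁻¹ • y')) z := by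
    have := hΦd'.comp (z : E') hL; exact this
  exact mdifferentiableAt_of_repr hrep (hcomp.const_smul l)

omit hf' in
/-- **The differentials correspond, vector-valued targets**: for `φ : U → F`, `φ' : U' → F` with
`φ' z = l φ (σ z)`, `dφ'_z = dφ_{σ z}` (as maps of `E'`), for `φ` differentiable at `σ z`.
[folklore] -/
theorem mfderiv_dilate_apply' {F : Type*} [NormedAddCommGroup F] [NormedSpace ℝ F]
    {φ : U → F} {φ' : U' → F} (hφ' : ∀ z, φ' z = l • φ (σ z)) {z : U'}
    (hφd : MDifferentiableAt 𝓘(ℝ, E') 𝓘(ℝ, F) φ (σ z)) (v : E') :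
    mfderiv 𝓘(ℝ, E') 𝓘(ℝ, F) φ' z v = mfderiv 𝓘(ℝ, E') 𝓘(ℝ, F) φ (σ z) v := by
  classical
  set Φ : E' → F := fun y ↦ if h : y ∈ U then φ ⟨y, h⟩ else 0 with hΦdef
  have hΦ : ∀ y : U, φ y = Φ y := fun y ↦ by simp [hΦdef, dif_pos y.2]
  have hΦd : DifferentiableAt ℝ Φ (σ z) := (mdifferentiableAt_iff (σ z) φ Φ hΦ).1 hφd
  have hΦd' : DifferentiableAt ℝ Φ (l⁻¹ • (z : E')) := by rw [← hσ]; exact hΦd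
  have hrep : ∀ y : U', φ' y = (fun y' : E' ↦ l • Φ (l⁻¹ • y')) y := fun y ↦ by
    simp only [hφ', hΦ, hσ]
  have hL : DifferentiableAt ℝ (fun y' : E' ↦ l⁻¹ • y') z :=
    (l⁻¹ • ContinuousLinearMap.id ℝ E').differentiableAt
  have hcomp : DifferentiableAt ℝ (fun y' : E' ↦ Φ (l⁻¹ • y')) z := by
    have := hΦd'.comp (z : E') hL; exact this
  have hΦ'd : DifferentiableAt ℝ (fun y' : E' ↦ l • Φ (l⁻¹ • y')) z := hcomp.const_smul l
  rw [mfderiv_eq z φ' _ hrep hΦ'd, mfderiv_eq (σ z) φ Φ hΦ hΦd, fderiv_fun_const_smul hcomp,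
    show (fun y' : E' ↦ Φ (l⁻¹ • y')) = Φ ∘ (fun y' : E' ↦ l⁻¹ • y') from rfl,
    fderiv_comp (z : E') hΦd' hL]
  have hfL : fderiv ℝ (fun y' : E' ↦ l⁻¹ • y') (z : E') = l⁻¹ • ContinuousLinearMap.id ℝ E' :=
    (l⁻¹ • ContinuousLinearMap.id ℝ E').fderiv
  rw [hfL, hσ]
  change l • fderiv ℝ Φ (l⁻¹ • (z : E')) (l⁻¹ • v) = fderiv ℝ Φ (l⁻¹ • (z : E')) v
  rw [map_smul, smul_smul, mul_inv_cancel₀ hl.ne', one_smul]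

omit hf' hl in
/-- `φ'` is differentiable where `φ` is (vector-valued targets). [folklore] -/
theorem mdifferentiableAt_dilate' {F : Type*} [NormedAddCommGroup F] [NormedSpace ℝ F]
    {φ : U → F} {φ' : U' → F} (hφ' : ∀ z, φ' z = l • φ (σ z)) {z : U'}
    (hφd : MDifferentiableAt 𝓘(ℝ, E') 𝓘(ℝ, F) φ (σ z)) :
    MDifferentiableAt 𝓘(ℝ, E') 𝓘(ℝ, F) φ' z := by
  classical
  set Φ : E' → F := fun y ↦ if h : y ∈ U then φ ⟨y, h⟩ else 0 with hΦdef
  have hΦ : ∀ y : U, φ y = Φ y := fun y ↦ by simp [hΦdef, dif_pos y.2]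
  have hΦd : DifferentiableAt ℝ Φ (σ z) := (mdifferentiableAt_iff (σ z) φ Φ hΦ).1 hφd
  have hΦd' : DifferentiableAt ℝ Φ (l⁻¹ • (z : E')) := by rw [← hσ]; exact hΦd
  have hrep : ∀ y : U', φ' y = (fun y' : E' ↦ l • Φ (l⁻¹ • y')) y := fun y ↦ by
    simp only [hφ', hΦ, hσ]
  have hL : DifferentiableAt ℝ (fun y' : E' ↦ l⁻¹ • y') z :=
    (l⁻¹ • ContinuousLinearMap.id ℝ E').differentiableAt
  have hcomp : DifferentiableAt ℝ (fun y' : E' ↦ Φ (l⁻¹ • y')) z := by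
    have := hΦd'.comp (z : E') hL; exact this
  exact (mdifferentiableAt_iff z φ' _ hrep).2 (hcomp.const_smul l)

omit hf' hl in
/-- **The chart-straight curves correspond under `t ↦ t/l`**: `σ (curveThrough z v t) =
curveThrough (σ z) v (t/l)` for small `|t|`. [folklore] -/
theorem sigma_curveThrough_eventuallyEq (z : U') (v : E') :
    (fun t ↦ σ (curveThrough 𝓘(ℝ, E') z v t)) =ᶠ[𝓝 (0 : ℝ)]
      fun t ↦ curveThrough 𝓘(ℝ, E') (σ z) v (l⁻¹ * t) := by
  have h1 := coe_curveThrough_eventuallyEq z v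
  have h2 : ∀ᶠ t in 𝓝 (0 : ℝ), ((curveThrough 𝓘(ℝ, E') (σ z) v (l⁻¹ * t) : U) : E') =
      (σ z : E') + (l⁻¹ * t) • v := by
    have hc : Tendsto (fun t : ℝ ↦ l⁻¹ * t) (𝓝 0) (𝓝 0) :=
      (continuous_const.mul continuous_id).tendsto' 0 0 (by simp)
    exact hc.eventually (coe_curveThrough_eventuallyEq (σ z) v)
  filter_upwards [h1, h2] with t ht ht'
  apply Subtype.ext
  rw [hσ, ht, ht', hσ, smul_add, smul_smul]

variable [g.HasLeviCivita] [g'.HasLeviCivita]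
  (hG : ∀ x : V, g.val x = G x) (hG' : ∀ x' : V', g'.val x' = G (l⁻¹ • (x' : E)))
include hG hG'

omit [Fact (1 ≤ n)] in
/-- **Dilation covariance of `D_v ν`** (junk values included): `D^{g'}_v ν' (z) = l⁻¹ D^{g}_v ν (σ z)`
for `ν' = ν ∘ σ`, at a point where `f` is differentiable and `G` is differentiable at `f (σ z)`.
O'Neill 1983, Ch. 3, Prop. 3.18 with Ch. 4, Lemma 4.1. [cite: ONeill1983, Ch. 4, Lemma 4.1] -/
theorem normalDerivAlong_dilate {ν : NormalField 𝓘(ℝ, E) f} {ν' : NormalField 𝓘(ℝ, E) f'}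
    (hν' : ∀ z, (ν' z : E) = ν (σ z)) {z : U'} (hfd : MDifferentiableAt 𝓘(ℝ, E') 𝓘(ℝ, E) f (σ z))
    (hGd : DifferentiableAt ℝ G (f (σ z))) (v : E') :
    g'.normalDerivAlong (I' := 𝓘(ℝ, E')) f' ν' z v =
      l⁻¹ • g.normalDerivAlong (I' := 𝓘(ℝ, E')) f ν (σ z) v := by
  have hint : (𝓘(ℝ, E')).IsInteriorPoint (σ z) := BoundarylessManifold.isInteriorPoint
  have hint' : (𝓘(ℝ, E')).IsInteriorPoint z := BoundarylessManifold.isInteriorPoint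
  have hf'd : MDifferentiableAt 𝓘(ℝ, E') 𝓘(ℝ, E) f' z := mdifferentiableAt_dilate hσ hf' hfd
  have hc'0 : curveThrough 𝓘(ℝ, E') z v 0 = z := curveThrough_zero _ z v
  have hc0 : curveThrough 𝓘(ℝ, E') (σ z) v 0 = σ z := curveThrough_zero _ (σ z) v
  -- both sides by the frame formula (definitional unfolding in the constant frame of the chart)
  unfold PseudoRiemannianMetric.normalDerivAlong
  have lhs := covariantDerivAlong_eq_sum g'.leviCivita (f' ∘ curveThrough 𝓘(ℝ, E') z v)
    (fun t ↦ ν' (curveThrough 𝓘(ℝ, E') z v t)) 0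
  have rhs := covariantDerivAlong_eq_sum g.leviCivita (f ∘ curveThrough 𝓘(ℝ, E') (σ z) v)
    (fun t ↦ ν (curveThrough 𝓘(ℝ, E') (σ z) v t)) 0
  simp only [id] at lhs rhs
  refine (lhs.trans ?_).trans (congrArg (l⁻¹ • ·) rhs).symm
  rw [smul_add, Finset.smul_sum, Finset.smul_sum]
  congr 1
  · -- derivative terms: the coefficient functions correspond under `t ↦ t/l`
    refine Finset.sum_congr rfl fun i _ ↦ ?_
    rw [smul_smul]
    congr 1
    have hev : (fun t ↦ (Module.finBasis ℝ E).repr (ν' (curveThrough 𝓘(ℝ, E') z v t)) i) =ᶠ[𝓝 0]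
        ((fun s ↦ (Module.finBasis ℝ E).repr (ν (curveThrough 𝓘(ℝ, E') (σ z) v s)) i) <| l⁻¹ * ·) := by
      filter_upwards [sigma_curveThrough_eventuallyEq hσ z v] with t ht
      rw [hν', ht]
    rw [hev.deriv_eq]
    have hd := deriv_comp_mul_left l⁻¹
      (fun s ↦ (Module.finBasis ℝ E).repr (ν (curveThrough 𝓘(ℝ, E') (σ z) v s)) i) (0 : ℝ)
    rw [mul_zero, smul_eq_mul] at hd
    exact hd
  · -- connection terms: `Γ' = l⁻¹ Γ` and `(f' ∘ c')'(0) = (f ∘ c)'(0)`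
    refine Finset.sum_congr rfl fun i _ ↦ ?_
    rw [smul_comm]
    have hvel' : velocity 𝓘(ℝ, E) (f' ∘ curveThrough 𝓘(ℝ, E') z v) 0 =
        mfderiv 𝓘(ℝ, E') 𝓘(ℝ, E) f (σ z) v := by
      rw [velocity_comp_zero (by rw [hc'0]; exact hf'd) (mdifferentiableAt_curveThrough_zero hint' v),
        velocity_curveThrough_zero_holds hint' v, hc'0]
      exact mfderiv_dilate_apply hl hσ hf' hfd v
    have hvel : velocity 𝓘(ℝ, E) (f ∘ curveThrough 𝓘(ℝ, E') (σ z) v) 0 =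
        mfderiv 𝓘(ℝ, E') 𝓘(ℝ, E) f (σ z) v := by
      rw [velocity_comp_zero (by rw [hc0]; exact hfd) (mdifferentiableAt_curveThrough_zero hint v),
        velocity_curveThrough_zero_holds hint v, hc0]
    have hpt' : (f' ∘ curveThrough 𝓘(ℝ, E') z v) 0 = f' z := by simp [hc'0]
    have hpt : (f ∘ curveThrough 𝓘(ℝ, E') (σ z) v) 0 = f (σ z) := by simp [hc0]
    have hGd'' : DifferentiableAt ℝ (fun x ↦ G (l⁻¹ • x)) (f' z) := by
      have h1 : DifferentiableAt ℝ G (l⁻¹ • (f' z : E)) := by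
        rw [inv_smul_coe_eq hl hf']; exact hGd
      exact h1.comp (f' z : E) (l⁻¹ • ContinuousLinearMap.id ℝ E).differentiableAt
    rw [hvel', hvel, hpt', hpt, hc'0, hc0, hν', leviCivita_const_apply hG' (f' z) hGd'',
      leviCivita_const_apply hG (f (σ z)) hGd,
      christoffel_shrink hG hG' (inv_smul_coe_eq hl hf' z) hGd]

variable [FiniteDimensional ℝ E']

omit [Fact (1 ≤ n)] in
/-- **Dilation covariance of the second fundamental form** (junk values included):
`K^{g'}_{f',ν'}(z) = l⁻¹ K^{g}_{f,ν}(σ z)` as bilinear forms on `E'`. O'Neill 1983, Ch. 4,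
Lemma 4.4. [cite: ONeill1983, Ch. 4, Lemma 4.4] -/
theorem secondFundamentalForm_dilate {ν : NormalField 𝓘(ℝ, E) f} {ν' : NormalField 𝓘(ℝ, E) f'}
    (hν' : ∀ z, (ν' z : E) = ν (σ z)) {z : U'} (hfd : MDifferentiableAt 𝓘(ℝ, E') 𝓘(ℝ, E) f (σ z))
    (hGd : DifferentiableAt ℝ G (f (σ z))) :
    (show LinearMap.BilinForm ℝ E' from g'.secondFundamentalForm 𝓘(ℝ, E') f' ν' z) =
      l⁻¹ • (show LinearMap.BilinForm ℝ E' from g.secondFundamentalForm 𝓘(ℝ, E') f ν (σ z)) := by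
  set bE := Module.finBasis ℝ E' with hbE
  refine bE.ext fun i ↦ LinearMap.ext fun w ↦ ?_
  have h1 : g'.secondFundamentalForm 𝓘(ℝ, E') f' ν' z (bE i) w =
      g'.val (f' z) (g'.normalDerivAlong (I' := 𝓘(ℝ, E')) f' ν' z (bE i)) (mfderiv 𝓘(ℝ, E') 𝓘(ℝ, E) f' z w) :=
    PseudoRiemannianMetric.secondFundamentalForm_apply_basis g' (I' := 𝓘(ℝ, E')) f' ν' z i w
  have h2 : g.secondFundamentalForm 𝓘(ℝ, E') f ν (σ z) (bE i) w =
      g.val (f (σ z)) (g.normalDerivAlong (I' := 𝓘(ℝ, E')) f ν (σ z) (bE i)) (mfderiv 𝓘(ℝ, E') 𝓘(ℝ, E) f (σ z) w) :=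
    PseudoRiemannianMetric.secondFundamentalForm_apply_basis g (I' := 𝓘(ℝ, E')) f ν (σ z) i w
  change g'.secondFundamentalForm 𝓘(ℝ, E') f' ν' z (bE i) w =
    l⁻¹ * g.secondFundamentalForm 𝓘(ℝ, E') f ν (σ z) (bE i) w
  rw [h1, h2, hG', hG]
  have hN : (id (g'.normalDerivAlong (I' := 𝓘(ℝ, E')) f' ν' z (bE i)) : E) =
      l⁻¹ • (id (g.normalDerivAlong (I' := 𝓘(ℝ, E')) f ν (σ z) (bE i)) : E) :=
    normalDerivAlong_dilate hl hσ hf' hG hG' hν' hfd hGd (bE i)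
  have hd : (id (mfderiv 𝓘(ℝ, E') 𝓘(ℝ, E) f' z w) : E) = (id (mfderiv 𝓘(ℝ, E') 𝓘(ℝ, E) f (σ z) w) : E) :=
    mfderiv_dilate_apply hl hσ hf' hfd w
  have hx := inv_smul_coe_eq hl hf' z
  change G (l⁻¹ • (f' z : E)) (id (g'.normalDerivAlong (I' := 𝓘(ℝ, E')) f' ν' z (bE i)) : E)
      (id (mfderiv 𝓘(ℝ, E') 𝓘(ℝ, E) f' z w) : E) =
    l⁻¹ * G (f (σ z) : E) (id (g.normalDerivAlong (I' := 𝓘(ℝ, E')) f ν (σ z) (bE i)) : E)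
      (id (mfderiv 𝓘(ℝ, E') 𝓘(ℝ, E) f (σ z) w) : E)
  rw [hx, hN, hd, map_smul, FunLike.coe_smul, Pi.smul_apply, smul_eq_mul]

end OpensChart

end Literature.Geometry.Lorentzian

end
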